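import Literature.NumberTheory.EllipticCurves.ComplexMultiplicationBurungaleFlachAssemblyProofs
import Literature.NumberTheory.EllipticCurves.ComplexMultiplicationTwistIsogenyCertProofs
import Literature.NumberTheory.EllipticCurves.ComplexMultiplicationShaHeckeProofs
import HarnessLib

/-!
# Burungale–Flach, Corollary 2 (the descent `K → ℚ`), level 5: the leaves of complex
multiplication

Fifth level of the decomposition of the named fact
`Literature.NumberTheory.EllipticCurves.BurungaleFlach2024_bsd_rat_of_bsd_cmField`
(`ComplexMultiplicationBurungaleFlachDescent.lean`): the proof of Burungale–Flach, Camb. J. Math.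
12 (2024), Cor. 2 at `F⁺ = ℚ` — the rank-zero Birch–Swinnerton-Dyer formula for `E_K/K` (`K` the
CM field of the CM curve `E/ℚ`) implies the one for `E/ℚ` (Weil restriction, Milne 1972 Thm. 1;
`E_ε ∼ E`, Milne 1972 Thm. 3; isogeny invariance; "taking square roots"). Levels 3–4
(`ComplexMultiplicationBurungaleFlachDescentProofs.lean`, `…TwistIsogenyProofs.lean`) derived the
fact from the *generic* quadratic descent `WeierstrassCurve.bsd_rat_of_bsd_imaginaryQuadratic`
(`BSDQuadraticDescent.lean`) and so from six named facts stated for *all* elliptic curves over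
`ℚ`: modularity (`hasEntireLFunction_rat`), Artin formalism (`LSeries_baseChange_quadratic`),
Milne's theorem in quotient form (`bsdRHS_baseChange_quadratic`), Cassels' isogeny invariance
(`bsdRHS_eq_of_isIsogenous`), Knapp 11.67 (`LFunction_eq_of_isIsogenous`) and `L(E,1) ≥ 0`
(`re_entireLFunction_one_nonneg`), plus the CM twist isogeny `E ∼ E^{(d_K)}`, since discharged
(`isIsogenous_quadraticTwist_cmFieldDiscr_holds`, `…TwistIsogenyCertProofs.lean`).

Three of the six generic leaves enter the generic descent only to produce the single identity
`L(E_K/K, 1) = L(E/ℚ, 1)²` for the entire continuations: modularity (continuation of `L(E, s)` and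
`L(E^{(D)}, s)`), Artin formalism (`L(E_K/K, s) = L(E, s) L(E^{(D)}, s)`) and Knapp 11.67
(`L(E^{(D)}, s) = L(E, s)` along `E ∼ E^{(D)}`). For a CM curve and its CM field this identity *is*
Deuring's theorem — `L(E_K/K, s) = L(ψ, s) L(ψ̄, s)`, `L(E/ℚ, s) = L(ψ, s)` (Silverman, *Advanced
Topics*, II.10.5; the identity Burungale–Flach themselves invoke in the proof of Cor. 1,
`L(E/F,s) = L(ψ̄,s) L(ψ,s)`, Shimura Thm. 7.42) — already vendored in the tree, for the `Ш` part of
bsd.S28, as `Deuring_LFunction_baseChange_cmField` (`(W_K).LFunction = W.LFunction²` in Mathlib's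
`ArithmeticFunction ℤ`), together with the Deuring–Hecke continuation of `L(E/ℚ, s)` for CM by `𝓞_K`
(`hasEntireLFunction_of_j_mem_maximalCMJInvariants`, Silverman *Advanced Topics* II Cor. 10.5.1,
`ComplexMultiplicationShaHeckeProofs.lean`). This file reruns the descent on these two CM leaves:

* `ArithmeticFunction.eq_zero_of_mul_eq_zero_of_apply_one_ne_zero`,
  `ArithmeticFunction.eq_of_mul_self_eq_mul_self` (**proved**, elementary): in the Dirichlet ring
  over a ring without zero divisors, `d * s = 0` with `s(1) ≠ 0` forces `d = 0`; hence
  `f * f = g * g` with `f(1) + g(1) ≠ 0` forces `f = g` (square roots of formal Dirichlet series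
  are unique up to the sign of the leading coefficient);
* `LFunction_quadraticTwist_eq_of_Deuring` (**proved**): Deuring's identity alone gives
  `L(E^{(c)}, s) = L(E, s)` for every `c` with `ℚ(√c) =` the CM field — both curves have CM by
  `𝓞_K` with the same CM field and become isomorphic over `K`, so `L(E,s)² = L(E_K/K,s) =
  L(E^{(c)}_K/K, s) = L(E^{(c)}, s)²`, and one takes the square root with leading coefficient
  `a₁ = 1`. This is the Knapp-free form of "`E_ε` is isogenous to `E`, hence has the same
  `L`-function" for the twist by the CM character;
* `WeierstrassCurve.bsd_rat_of_bsd_imaginaryQuadratic_of_LFunction_eq_mul_self` (**proved**): the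
  generic descent theorem of `BSDQuadraticDescent.lean` with the three analytic leaves replaced by
  exactly what they were used for — `W.HasEntireLFunction` and
  `(W_K).LFunction = W.LFunction * W.LFunction` for the one curve `W` at hand;
* `BurungaleFlach2024_bsd_rat_of_bsd_cmField_of_level5` (**proved**): the descent fact from the
  five leaves `hasEntireLFunction_of_j_mem_maximalCMJInvariants` (Deuring–Hecke),
  `Deuring_LFunction_baseChange_cmField` (Deuring), `bsdRHS_baseChange_quadratic` (Milne 1972,
  Thm. 1), `bsdRHS_eq_of_isIsogenous` (Cassels) and `re_entireLFunction_one_nonneg` (`L(E,1) ≥ 0`);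
  `…_of_level5_of_level3` records that these five are implied by the six of level 3 (by the
  tree's `Deuring_LFunction_baseChange_cmField_of_artinFormalism` and
  `hasEntireLFunction_of_j_mem_maximalCMJInvariants_of_hasEntireLFunction_rat`), so level 5
  refines level 3 rather than trading leaves;
After this file `BurungaleFlach2024_bsd_rat_of_bsd_cmField` rests, sorry-free, on: Deuring–Hecke
continuation and Deuring's identity (theory of complex multiplication, ≤ 1955), Milne 1972 Thm. 1
(Weil restriction), Cassels 1965 (isogeny invariance of the BSD quotient) and the sign
`L(E,1) ≥ 0` (Guo 1996 / Lapid–Rallis 2003) — the last three being exactly the inputs the printed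
proof of Cor. 2 names or leaves implicit. The sibling
`ComplexMultiplicationBurungaleFlachNineLeavesProofs.lean` reruns the bsd.S28 assembly on it.

## Design and faithfulness notes

* Nothing is restated and no named fact is introduced: every hypothesis is an existing named
  fact of the tree and the conclusion is literally the existing leaf
  `BurungaleFlach2024_bsd_rat_of_bsd_cmField`.
* The two Dirichlet-ring lemmas are deliberate additions to Mathlib's `ArithmeticFunction`
  namespace (dot-notation on `ArithmeticFunction`; Mathlib has `mul_apply`, `one_apply` but no
  cancellation or integral-domain statement for `ArithmeticFunction R`, searched `NoZeroDivisors`,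
  `IsDomain` in `NumberTheory/ArithmeticFunction`). The curve-specific descent variant is a
  dot-notation extension in `namespace WeierstrassCurve`, next to the theorem it varies.
* Group rules of the topic: `noncomputable section`, `open scoped Classical`; `K : Type` in the
  CM statements (the facts quantify over `K : Type`).

## References

* A. Burungale, M. Flach, *The conjecture of Birch and Swinnerton-Dyer for certain elliptic curves
  with complex multiplication*, Camb. J. Math. 12 (2024) (arXiv:2206.09874): Cor. 1 and its proof
  (Shimura 7.42), Cor. 2 and its proof, Remark 10 (arXiv pp. 3–4, 19). [BurungaleFlach2024]
* J. S. Milne, *On the arithmetic of abelian varieties*, Invent. Math. 17 (1972), Thm. 1, Thm. 3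
  and Corollary (through [BurungaleFlach2024]). [Milne1972ArithmeticAV]
* J. H. Silverman, *Advanced Topics in the Arithmetic of Elliptic Curves*, GTM 151 (1994), Ch. II
  Thm. 10.5 (Deuring) and Cor. 10.5.1 (Deuring–Hecke). [SilvermanATAEC1994]
* J. H. Silverman, *The Arithmetic of Elliptic Curves*, 2nd ed. (2009), X.5 Cor. 5.4, App. C §16.
-/

noncomputable section

open scoped Classical

/-! ### Cancellation in the Dirichlet ring -/

namespace ArithmeticFunction

variable {R : Type*} [CommRing R] [NoZeroDivisors R]

/-- **Cancellation in the Dirichlet ring.** If `d * s = 0` for arithmetic functions over a ring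
without zero divisors and the leading coefficient `s 1` is nonzero, then `d = 0`: comparing
coefficients at `n`, `(d * s)(n) = d(n) s(1) + ∑_{ab = n, b ≠ 1} d(a) s(b)` and `d(a) = 0` for the
proper divisors `a < n` by induction. (Deliberate addition to Mathlib's `ArithmeticFunction`
namespace.) [folklore] -/
theorem eq_zero_of_mul_eq_zero_of_apply_one_ne_zero {d s : ArithmeticFunction R} (h : d * s = 0)
    (hs : s 1 ≠ 0) : d = 0 := by
  suffices H : ∀ n, d n = 0 by
    ext n
    rw [H n, zero_apply]
  intro n
  induction n using Nat.strong_induction_on with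
  | _ n ih =>
    rcases Nat.eq_zero_or_pos n with rfl | hn
    · exact d.map_zero
    · have key : (d * s) n = 0 := by rw [h, zero_apply]
      rw [mul_apply, Finset.sum_eq_single (n, 1)] at key
      · exact (mul_eq_zero.mp key).resolve_right hs
      · rintro ⟨a, b⟩ hab hne
        obtain ⟨hab', -⟩ := Nat.mem_divisorsAntidiagonal.mp hab
        have han : a ≠ n := by
          rintro rfl
          exact hne (Prod.ext rfl ((mul_eq_left₀ hn.ne').mp hab'))
        have ha : a < n := lt_of_le_of_ne (Nat.le_of_dvd hn (Dvd.intro b hab')) han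
        simp only [ih a ha, zero_mul]
      · intro h'
        exact absurd (Nat.mem_divisorsAntidiagonal.mpr ⟨mul_one n, hn.ne'⟩) h'

/-- **Square roots in the Dirichlet ring are unique up to sign**: over a ring without zero
divisors, `f * f = g * g` and `f 1 + g 1 ≠ 0` imply `f = g` (apply the cancellation lemma to
`(f - g) * (f + g) = 0`). Used with `f 1 = g 1 = 1` for `L`-functions of elliptic curves.
(Deliberate addition to Mathlib's `ArithmeticFunction` namespace.) [folklore] -/
theorem eq_of_mul_self_eq_mul_self {f g : ArithmeticFunction R} (h : f * f = g * g)
    (h1 : f 1 + g 1 ≠ 0) : f = g := by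
  have hds : (f - g) * (f + g) = 0 := by linear_combination h
  have hs : (f + g) 1 ≠ 0 := by rwa [add_apply]
  exact sub_eq_zero.mp (eq_zero_of_mul_eq_zero_of_apply_one_ne_zero hds hs)

end ArithmeticFunction

/-! ### `L(E^{(c)}, s) = L(E, s)` for the twist by the CM field, from Deuring's identity -/

namespace Literature.NumberTheory.EllipticCurves

open WeierstrassCurve NumberField

/-- **A square root of `d_K` generating the CM field.** For `K` with `IsCMFieldOfJ K j`
(`[K : ℚ] = 2`, `d_K = cmFieldDiscr j` a square in `K`) and `j ∈ maximalCMJInvariants`, a square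
root `θ` of `d_K` in `K` is irrational (`d_K < 0`), so `K = ℚ(θ)`. [folklore] -/
theorem IsCMFieldOfJ.exists_sqrt {K : Type*} [Field K] [CharZero K] {j : ℚ}
    (hj : j ∈ maximalCMJInvariants) (hK : IsCMFieldOfJ K j) :
    ∃ θ : K, θ ∉ Set.range (algebraMap ℚ K) ∧ θ ^ 2 = algebraMap ℚ K (cmFieldDiscr j : ℚ) := by
  obtain ⟨θ, hθ⟩ := hK.2
  have hd : cmFieldDiscr j < 0 := cmFieldDiscr_neg hj
  refine ⟨θ, ?_, by rw [hθ, map_intCast]⟩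
  rintro ⟨q, hq⟩
  have h1 : (algebraMap ℚ K) (q ^ 2) = (algebraMap ℚ K) (cmFieldDiscr j : ℚ) := by
    rw [map_pow, hq, hθ, map_intCast]
  have h2 : q ^ 2 = (cmFieldDiscr j : ℚ) := (algebraMap ℚ K).injective h1
  have h3 : (0 : ℚ) ≤ q ^ 2 := sq_nonneg q
  have h4 : ((cmFieldDiscr j : ℤ) : ℚ) < 0 := by exact_mod_cast hd
  linarith

/-- **Over `K = ℚ(√c)` the twist `E^{(c)}` and `E` have the same `L`-function over `K`**: they are
`K`-isomorphic (`twistUntwist_smul_baseChange`, Silverman *AEC* X.5 Cor. 5.4: `u = √c` carries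
`E^{(c)}_K` to `E^{(1)}_K ≅ E_K`), and Mathlib's `WeierstrassCurve.LFunction` is an isomorphism
invariant (`LFunction_smul`). [cite: SilvermanAEC2009, X.5 Cor. 5.4 with App. C §16] -/
theorem LFunction_baseChange_quadraticTwist_eq (W : WeierstrassCurve ℚ) [W.IsElliptic]
    (K : Type*) [Field K] [NumberField K] {θ : K} {c : ℚ}
    (hθ : θ ∉ Set.range (algebraMap ℚ K)) (hc : θ ^ 2 = algebraMap ℚ K c) :
    ((W.quadraticTwist c).baseChange K).LFunction = (W.baseChange K).LFunction := by
  have hc0 : c ≠ 0 := QuadraticFields.Quadratic.sq_ne_zero_of_not_mem_range hθ hc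
  haveI : (W.quadraticTwist c).IsElliptic := W.isElliptic_quadraticTwist hc0
  haveI : (W.baseChange K).IsElliptic := by rw [baseChange]; infer_instance
  haveI : ((W.quadraticTwist c).baseChange K).IsElliptic := by rw [baseChange]; infer_instance
  obtain ⟨C, hC⟩ := W.exists_variableChange_quadraticTwist_one
  calc ((W.quadraticTwist c).baseChange K).LFunction
      = (twistUntwist hθ • (W.quadraticTwist c).baseChange K).LFunction :=
        (LFunction_smul ((W.quadraticTwist c).baseChange K) (twistUntwist hθ)).symm
    _ = ((W.quadraticTwist 1).baseChange K).LFunction := by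
        rw [twistUntwist_smul_baseChange W hθ hc]
    _ = (C.map (algebraMap ℚ K) • W.baseChange K).LFunction := by
        rw [← hC, VariableChange.baseChange_smul_eq]
    _ = (W.baseChange K).LFunction := LFunction_smul (W.baseChange K) _

/-- **Deuring's identity gives `L(E^{(c)}, s) = L(E, s)` for the twist by the CM field**
(Knapp-free). Let `E/ℚ` have CM by `𝓞_K` (`j(E) ∈ maximalCMJInvariants`), `K ≅ ℚ(√d_K)` its CM
field (`IsCMFieldOfJ K j(E)`) and `c ∈ ℚ` with `K = ℚ(√c)` (e.g. `c = d_K`, or `c = disc K`).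
The twist `E^{(c)}` has the same `j`-invariant, hence CM by `𝓞_K` with the same CM field, so
Deuring's theorem (`hD : Deuring_LFunction_baseChange_cmField`, Silverman *Advanced Topics*
II.10.5 in the form `L(E_K/K,s) = L(E/ℚ,s)²`) applies to both: `L(E,s)² = L(E_K/K,s) =
L(E^{(c)}_K/K,s) = L(E^{(c)},s)²` (`LFunction_baseChange_quadraticTwist_eq`), and formal
Dirichlet series with leading coefficient `1` have unique such square roots
(`ArithmeticFunction.eq_of_mul_self_eq_mul_self`, `LFunction_apply_one`). This is the content of
"`E_ε` is isogenous to `E`" + Knapp 11.67 for the character `ε` of `K/ℚ` (Burungale–Flach, proof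
of Cor. 2), obtained from CM theory instead.
[cite: SilvermanATAEC1994, Ch. II Thm. 10.5 (a), (b) (Deuring)]
[cite: BurungaleFlach2024, proof of Cor. 2 (arXiv p. 4)] -/
theorem LFunction_quadraticTwist_eq_of_Deuring (hD : Deuring_LFunction_baseChange_cmField)
    (W : WeierstrassCurve ℚ) [W.IsElliptic] (hj : W.j ∈ maximalCMJInvariants)
    (K : Type) [Field K] [NumberField K] (hK : IsCMFieldOfJ K W.j) {θ : K} {c : ℚ}
    (hθ : θ ∉ Set.range (algebraMap ℚ K)) (hc : θ ^ 2 = algebraMap ℚ K c) :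
    (W.quadraticTwist c).LFunction = W.LFunction := by
  have hc0 : c ≠ 0 := QuadraticFields.Quadratic.sq_ne_zero_of_not_mem_range hθ hc
  haveI : (W.quadraticTwist c).IsElliptic := W.isElliptic_quadraticTwist hc0
  have hjc : (W.quadraticTwist c).j = W.j := W.j_quadraticTwist hc0
  have h1 : (W.baseChange K).LFunction = W.LFunction * W.LFunction := hD W hj K hK
  have h2 : ((W.quadraticTwist c).baseChange K).LFunction =
      (W.quadraticTwist c).LFunction * (W.quadraticTwist c).LFunction :=
    hD (W.quadraticTwist c) (by rw [hjc]; exact hj) K (by rw [hjc]; exact hK)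
  rw [LFunction_baseChange_quadraticTwist_eq W K hθ hc, h1] at h2
  refine (ArithmeticFunction.eq_of_mul_self_eq_mul_self h2 ?_).symm
  rw [LFunction_apply_one, LFunction_apply_one]
  norm_num

/-- Hence, under Deuring's identity, the twist by the CM field has the same `L`-series, the same
entire continuation `WeierstrassCurve.entireLFunction` and in particular the same value
`L(E^{(c)}, 1) = L(E, 1)`. [cite: SilvermanATAEC1994, Ch. II Thm. 10.5 (a), (b) (Deuring)] -/
theorem entireLFunction_quadraticTwist_eq_of_Deuring (hD : Deuring_LFunction_baseChange_cmField)
    (W : WeierstrassCurve ℚ) [W.IsElliptic] (hj : W.j ∈ maximalCMJInvariants)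
    (K : Type) [Field K] [NumberField K] (hK : IsCMFieldOfJ K W.j) {θ : K} {c : ℚ}
    (hθ : θ ∉ Set.range (algebraMap ℚ K)) (hc : θ ^ 2 = algebraMap ℚ K c) :
    (W.quadraticTwist c).entireLFunction = W.entireLFunction :=
  entireLFunction_eq_of_LSeries_eq
    (LSeries_eq_of_LFunction_eq (LFunction_quadraticTwist_eq_of_Deuring hD W hj K hK hθ hc))

/-- The case `c = d_K` with the CM field realised abstractly (`exists_isCMFieldOfJ`): under
Deuring's identity, `L(E^{(d_K)}, s)` and `L(E, s)` have the same entire continuation.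
[cite: SilvermanATAEC1994, Ch. II Thm. 10.5 (a), (b) (Deuring)] -/
theorem entireLFunction_quadraticTwist_cmFieldDiscr_eq_of_Deuring
    (hD : Deuring_LFunction_baseChange_cmField) (W : WeierstrassCurve ℚ) [W.IsElliptic]
    (hj : W.j ∈ maximalCMJInvariants) :
    (W.quadraticTwist (cmFieldDiscr W.j : ℚ)).entireLFunction = W.entireLFunction := by
  obtain ⟨K, _, _, hK⟩ := exists_isCMFieldOfJ hj
  obtain ⟨θ, hθ, hc⟩ := hK.exists_sqrt hj
  exact entireLFunction_quadraticTwist_eq_of_Deuring hD W hj K hK hθ hc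

end Literature.NumberTheory.EllipticCurves

/-! ### The generic descent with the analytic inputs made pointwise -/

namespace WeierstrassCurve

open Complex NumberField Literature.NumberTheory.EllipticCurves

/-- **Descent of the rank-zero BSD formula from an imaginary quadratic field to `ℚ`, analytic
inputs pointwise** — the theorem `bsd_rat_of_bsd_imaginaryQuadratic` of `BSDQuadraticDescent.lean`
(Milne 1972, Cor. to Thm. 3 / Burungale–Flach 2024, proof of Cor. 2, with the sign made
explicit) with its three analytic leaves (modularity for `E` and `E^{(D)}`, Artin formalism,
Knapp 11.67 along `E ∼ E^{(D)}`) replaced by the only consequence the proof uses: `L(E, s)` has an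
entire continuation (`hW`) and `L(E_K/K, s) = L(E, s)²` as formal Dirichlet series (`hLK`), whence
`L(E_K/K, 1) = L(E, 1)²` for the continuations (`entireLFunction_one_eq_sq_of_LFunction_eq_mul_self`).
The rest is verbatim: `E(ℚ) ↪ E(K)` finite; `Ш(E/ℚ) → Ш(E_K/K)` has finite kernel; Milne's
theorem (`hBC`) `Ω(E_K)·#Ш(E_K)·∏c_v/#E(K)² = RHS(W)·RHS(Wd)` for a minimal model `Wd` of the
twist `E^{(D)}`, `D = disc K`; Cassels (`hISO`) `RHS(Wd) = RHS(W)` along `E ∼ E^{(D)}` (`hiso`);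
so `L(E,1)² = RHS(W)²` with `RHS(W) ≥ 0`, and `L(E,1) ≥ 0` (`hPOS`) gives `L(E,1) = RHS(W)`.
(Deliberate dot-notation extension of Mathlib's `WeierstrassCurve` namespace, next to the theorem
it varies.) [cite: BurungaleFlach2024, proof of Cor. 2 (arXiv p. 4)]
[cite: Milne1972ArithmeticAV, Thm. 1, Thm. 3 and Corollary (through BurungaleFlach2024)] -/
theorem bsd_rat_of_bsd_imaginaryQuadratic_of_LFunction_eq_mul_self
    (hBC : bsdRHS_baseChange_quadratic) (hISO : bsdRHS_eq_of_isIsogenous)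
    (hPOS : re_entireLFunction_one_nonneg)
    (W : WeierstrassCurve ℚ) [W.IsElliptic] [W.IsGloballyMinimal]
    (K : Type) [Field K] [NumberField K] [IsTotallyComplex K] (h2 : Module.finrank ℚ K = 2)
    (hiso : IsIsogenous W (W.quadraticTwist (NumberField.discr K : ℚ)))
    (hW : W.HasEntireLFunction) (hLK : (W.baseChange K).LFunction = W.LFunction * W.LFunction)
    (W' : WeierstrassCurve K) [W'.IsElliptic] [W'.IsGloballyMinimal]
    (hW' : ∃ C : VariableChange K, C • W.baseChange K = W')
    (hfin : Finite W'.toAffine.Point) (hsha : W'.ShaFinite)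
    (hform : W'.entireLFunction 1 / (W'.bsdPeriod : ℂ) =
      (W'.shaOrder : ℂ) / (Nat.card W'.toAffine.Point : ℂ) ^ 2 * (W'.tamagawaProduct : ℂ)) :
    Finite W.toAffine.Point ∧ W.ShaFinite ∧
      W.entireLFunction 1 / (W.realPeriodRat : ℂ) =
        (W.shaOrder : ℂ) / (Nat.card W.toAffine.Point : ℂ) ^ 2 * (W.tamagawaProduct : ℂ) := by
  obtain ⟨C, rfl⟩ := hW'
  set D : ℚ := (NumberField.discr K : ℚ) with hD_def
  have hD : D ≠ 0 := by
    rw [hD_def]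
    exact_mod_cast NumberField.discr_ne_zero K
  haveI hEt : (W.quadraticTwist D).IsElliptic := W.isElliptic_quadraticTwist hD
  haveI hEK : (W.baseChange K).IsElliptic := by rw [baseChange]; infer_instance
  -- (1) `E(ℚ)` is finite
  haveI hfinK : Finite (W.baseChange K).toAffine.Point :=
    Finite.of_equiv _ (VariableChange.pointEquiv (W.baseChange K) C).symm.toEquiv
  have hfinQ : Finite W.toAffine.Point := finite_point_of_finite_point_baseChange W K
  -- (2) a globally minimal model of the twist
  obtain ⟨CD, hCD⟩ := hasGlobalMinimalModel_rat_holds (W.quadraticTwist D)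
  haveI := hCD
  -- (3) `Ш(E/ℚ)` is finite (restriction to `K` has finite kernel); Milne: the quotients multiply
  have hshaQ : W.ShaFinite := by
    have e : (C • W.baseChange K).ShaFinite ↔ (W.baseChange K).ShaFinite :=
      shaFinite_variableChange_iff_holds (W.baseChange K) C
    exact Literature.NumberTheory.EllipticCurves.shaFinite_of_baseChange W K (e.mp hsha)
  have hRHS :=
    hBC W K h2 (CD • W.quadraticTwist D) ⟨CD, rfl⟩ (C • W.baseChange K) ⟨C, rfl⟩ hfin hsha
  -- (4) the twist is isogenous to `W`: same BSD quotient (Cassels)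
  have hisoD : IsIsogenous W (CD • W.quadraticTwist D) := hiso.smul_right CD
  obtain ⟨-, hRHSD⟩ := hISO W (CD • W.quadraticTwist D) hisoD hshaQ
  -- (5) `L(E_K,1) = L(E,1)²`
  have hLK1 : (C • W.baseChange K).entireLFunction 1 =
      W.entireLFunction 1 * W.entireLFunction 1 := by
    rw [entireLFunction_smul, entireLFunction_one_eq_sq_of_LFunction_eq_mul_self hW hLK, sq]
  -- (6) the formula over `K`, cleared of denominators
  have hΩK : 0 < (C • W.baseChange K).bsdPeriod := bsdPeriod_pos' _
  have hΩK' : ((C • W.baseChange K).bsdPeriod : ℂ) ≠ 0 := by exact_mod_cast hΩK.ne'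
  have hform' : (C • W.baseChange K).entireLFunction 1 =
      (((C • W.baseChange K).bsdPeriod * ((C • W.baseChange K).shaOrder : ℝ) *
          ((C • W.baseChange K).tamagawaProduct : ℝ) /
          (Nat.card (C • W.baseChange K).toAffine.Point : ℝ) ^ 2 : ℝ) : ℂ) := by
    rw [div_eq_iff hΩK'] at hform
    rw [hform]
    push_cast
    ring
  rw [hRHS, hRHSD] at hform'
  -- (7) square roots
  have hsq : W.entireLFunction 1 ^ 2 = (W.bsdRHS : ℂ) ^ 2 := by
    rw [sq, sq, ← hLK1, hform']
    push_cast
    ring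
  have hR : 0 ≤ W.bsdRHS := by
    haveI := hfinQ
    rw [W.bsdRHS_eq_of_finite]
    have hΩ : 0 < W.realPeriodRat := W.realPeriodRat_pos_holds
    positivity
  have hLR : W.entireLFunction 1 = (W.bsdRHS : ℂ) :=
    Complex.eq_of_sq_eq_sq_of_re_nonneg hR (hPOS W) hsq
  refine ⟨hfinQ, hshaQ, ?_⟩
  haveI := hfinQ
  have hΩ : (W.realPeriodRat : ℂ) ≠ 0 := by
    exact_mod_cast (ne_of_gt (W.realPeriodRat_pos_holds : 0 < W.realPeriodRat))
  rw [div_eq_iff hΩ, hLR, W.bsdRHS_eq_of_finite]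
  push_cast
  ring

end WeierstrassCurve

/-! ### Level 5: the descent fact from the leaves of complex multiplication -/

namespace Literature.NumberTheory.EllipticCurves

open WeierstrassCurve NumberField

/-- **Burungale–Flach's descent (`BurungaleFlach2024_bsd_rat_of_bsd_cmField`) from the leaves of
complex multiplication — level 5.** The named fact "rank-zero BSD for `E_K/K` ⇒ rank-zero BSD for
`E/ℚ`" (Burungale–Flach 2024, proof of Cor. 2 at `F⁺ = ℚ` = Milne 1972, Cor. to Thm. 3, for CM
curves over `ℚ`) follows from: the Deuring–Hecke continuation of `L(E/ℚ, s)` for CM by `𝓞_K`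
(`hH`, Silverman *Advanced Topics* II Cor. 10.5.1), Deuring's `L(E_K/K, s) = L(E/ℚ, s)²` (`hD`,
loc. cit. Thm. 10.5; the identity `L(E/F,s) = L(ψ̄,s)L(ψ,s)` of the proof of Cor. 1), Milne's
theorem on the BSD quotient of the Weil restriction (`hBC`), Cassels' isogeny invariance of the
BSD quotient (`hISO`) and the sign `L(E,1) ≥ 0` (`hPOS`), via
`bsd_rat_of_bsd_imaginaryQuadratic_of_LFunction_eq_mul_self`; the CM isogeny `E ∼ E^{(disc K)}`
fed to Cassels' theorem is the tree's theorem `isIsogenous_quadraticTwist_cmFieldDiscr_holds`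
(Milne 1972, Thm. 3, certified for all nine `j`), and the CM field is imaginary quadratic
(`IsCMFieldOfJ.isTotallyComplex`). Compared with level 3, modularity, Artin formalism and
Knapp 11.67 are replaced by the two CM statements they were used to produce
(`…_of_level5_of_level3`). [cite: BurungaleFlach2024, proof of Cor. 2 (arXiv p. 4)]
[cite: Milne1972ArithmeticAV, Thm. 1, Thm. 3 and Corollary (through BurungaleFlach2024)]
[cite: SilvermanATAEC1994, Ch. II Thm. 10.5 and Cor. 10.5.1] -/
theorem BurungaleFlach2024_bsd_rat_of_bsd_cmField_of_level5
    (hH : hasEntireLFunction_of_j_mem_maximalCMJInvariants)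
    (hD : Deuring_LFunction_baseChange_cmField)
    (hBC : bsdRHS_baseChange_quadratic) (hISO : bsdRHS_eq_of_isIsogenous)
    (hPOS : re_entireLFunction_one_nonneg) :
    BurungaleFlach2024_bsd_rat_of_bsd_cmField := by
  intro W _ _ hj _hL K _ _ hK W' _ _ hW' hBSDK
  haveI : IsTotallyComplex K := hK.isTotallyComplex hj
  exact bsd_rat_of_bsd_imaginaryQuadratic_of_LFunction_eq_mul_self hBC hISO hPOS W K hK.1
    (isIsogenous_quadraticTwist_discr_of_isCMFieldOfJ isIsogenous_quadraticTwist_cmFieldDiscr_holds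
      W hj K hK)
    (hH W hj) (hD W hj K hK) W' hW' hBSDK.1 hBSDK.2.1 hBSDK.2.2

/-- **Level 5 refines level 3**: the five leaves of `…_of_level5` are consequences of the six of
`BurungaleFlach2024_bsd_rat_of_bsd_cmField_of_level3` — the CM continuation is a special case of
modularity (`hasEntireLFunction_of_j_mem_maximalCMJInvariants_of_hasEntireLFunction_rat`) and
Deuring's identity follows from Artin formalism, Knapp 11.67 and the CM twist isogeny (a theorem)
(`Deuring_LFunction_baseChange_cmField_of_artinFormalism`). So the descent from the level-3 leaves
factors through level 5. [cite: BurungaleFlach2024, proof of Cor. 2 (arXiv p. 4)] -/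
theorem BurungaleFlach2024_bsd_rat_of_bsd_cmField_of_level5_of_level3
    (hmod : hasEntireLFunction_rat) (hBCL : LSeries_baseChange_quadratic)
    (hBC : bsdRHS_baseChange_quadratic) (hISO : bsdRHS_eq_of_isIsogenous)
    (hKn : LFunction_eq_of_isIsogenous) (hPOS : re_entireLFunction_one_nonneg) :
    BurungaleFlach2024_bsd_rat_of_bsd_cmField :=
  BurungaleFlach2024_bsd_rat_of_bsd_cmField_of_level5
    (hasEntireLFunction_of_j_mem_maximalCMJInvariants_of_hasEntireLFunction_rat hmod)
    (Deuring_LFunction_baseChange_cmField_of_artinFormalism hBCL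
      isIsogenous_quadraticTwist_cmFieldDiscr_holds hKn)
    hBC hISO hPOS

end Literature.NumberTheory.EllipticCurves

end
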